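import Summits.QuantumFields.BalabanUV.Beta.GAN24.MonotoneTorusSoft
import Summits.QuantumFields.BalabanUV.Beta.GAN24.MonotoneLimit

/-!
# Beta / GAN24 / MonotoneCovLimit — THE LIMIT OF THE CONSTRAINED COVARIANCES ALONG AN INCREASING, BOUNDED CHAIN OF DEGENERATE FORMS WITH STABLE
# CONSTRAINED KERNEL IS THE CONSTRAINED COVARIANCE OF THE LIMIT FORM (abstract, finite-dimensional; no rate)
# (gan24-p4 gen 4; BINDER-OWNERS row G-an2-4 ∕ (CONV-C), ALTERNATIVE DISCHARGE «rate OR monotonicity»; NOT IN PRINT — our proof attempt)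

HONEST FRAMING (page 1 of everything the β sub-cell writes): discharging `BetaPertH` makes Bałaban's UV stability UNCONDITIONAL — a
real constructive-QFT result; it is NOT the continuum limit and NOT the Clay problem.  HONEST DEPENDENCY (cell reorg 2026-08-19, verbatim):
«continuum YM on T⁴ ⇐ BetaPertH ∧ nine spine estimates (0/9 proved); BetaPertH ⇐ (D1) ∧ (D4) ∧ CAP+tail; G-an2-4 gates asym, D1 and NE2/3/4.»
HONEST LABEL: «not in print; our proof attempt; alternative discharge of the G-an2-4 row (rate OR monotonicity)»; 0 wall binders instantiated.
ABSOLUTE RULE honoured: nothing is cited; [folklore] finite-dimensional linear algebra and elementary topology (Mathlib: spectral theorem, compactness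
of spheres in finite dimension) over gen 1–4's `MonotoneLoewner` ∕ `MonotoneLimit` ∕ `MonotoneCoarsen` ∕ `MonotoneCritical` ∕ `MonotoneTorusSoft`.

## WHY ∕ WHAT (road P4, SKELETON-P4 node N6; MONOTONE.md §10 item (e)).  Gen 3∕4: the constrained plaquette covariances of `2Δ_k` decrease in `k` and
converge, `Δ_k` increases and is bounded.  To IDENTIFY the limit covariance with the constrained covariance of `Δ_∞ = lim Δ_k` one needs continuity of
`critCov H Q` along increasing chains of DEGENERATE forms — false in general (ranks may jump), true when the constrained kernel `ker Q ∩ ker H_k` is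
`k`-independent (on the torus: the closed 1-forms).  PROVED: §1 `hpinv_mulVec_of_ker`, **`critCov_orth_zeroModes`** (columns of `critCov` ⊥ `ker Q ∩ ker H`);
§2 **`exists_coercive`** (a PSD form with no null vector in a subspace is coercive there — compact unit sphere); §3 `posSemidef_sub_of_mono`, `tendsto_pairing`,
`isHermitian_of_tendsto`, `posSemidef_of_tendsto`, `posSemidef_limit_sub` (`H k ≤ Hinf`), `exists_tendsto_of_mono_bounded` (gen 1's `MonotoneLimit` on `U − H k`);
§4 **`pairing_critCov_tendsto`**: kernel stability + legitimate source ⟹ `⟨r, critCov (H k) Q r⟩ → ⟨r, critCov Hinf Q r⟩` (`0 ≤ p_k − p_∞ ≤ ⟨v_k,(Hinf − H_k)v_k⟩`,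
`v_k` uniformly bounded by §1–§2 and `re⟨v_k,H_kv_k⟩ = re⟨v_k,r⟩`); §5 **`readOut_critCov_tendsto`**: `T·critCov (H k) Q·Tᴴ → T·critCov Hinf Q·Tᴴ` entrywise
for every `T` killing `ker Q ∩ ker H₀` (polarisation).  Consumer: `GAN24/MonotoneTorusEffectiveLimit`.
NOT (CONV-C), NOT BetaPertH, NOT continuum, NOT Clay.
-/

noncomputable section

namespace Summit.QuantumFields.BalabanUV.Beta.GAN24.MonotoneCovLimit

open Matrix Filter Topology
open scoped ComplexOrder ComplexConjugate
open Summit.QuantumFields.BalabanUV.Beta.GAN24.MonotoneCoarsen (IsCrit qfun conj_pairing qfun_le_of_isCrit qfun_crit_eq_pairing)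
open Summit.QuantumFields.BalabanUV.Beta.GAN24.MonotoneCritical (hpinv hpinv_isHermitian star_unitary_mulVec_apply kerProj kerProj_pairing
  kerProj_mulVec_of_mem_ker isHermitian_compress critCov critCov_isHermitian isCrit_critCov critCov_mem_ker mulVec_critCov_mem_ker)
open Summit.QuantumFields.BalabanUV.Beta.GAN24.MonotoneShorted (readOut_quad mem_ker_iff)
open Summit.QuantumFields.BalabanUV.Beta.GAN24.MonotoneTorusSoft (qfun_mono_form ker_of_ker_larger)
open Summit.QuantumFields.BalabanUV.Beta.GAN24.MonotoneLoewner (posSemidef_of_isHermitian_re_nonneg)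
open Summit.QuantumFields.BalabanUV.Beta.GAN24.MonotoneLimit (exists_tendsto_apply_of_steps)

variable {n m τ : Type*} [Fintype n] [DecidableEq n] [Fintype m] [DecidableEq m] [Fintype τ] [DecidableEq τ]

/-! ## §1 The columns of `critCov` are orthogonal to the constrained zero modes -/

section Orth

/-- **THE HERMITIAN PSEUDO-INVERSE KILLS THE KERNEL**: `A z = 0 ⟹ A⁺ z = 0`. [folklore] -/
theorem hpinv_mulVec_of_ker {A : Matrix n n ℂ} (hA : A.IsHermitian) {z : n → ℂ} (hz : A *ᵥ z = 0) : hpinv hA *ᵥ z = 0 := by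
  set U : Matrix n n ℂ := (hA.eigenvectorUnitary : Matrix n n ℂ) with hU
  set Dp : Matrix n n ℂ := diagonal (fun i => ((RCLike.ofReal (hA.eigenvalues i) : ℂ))⁻¹) with hDp
  -- the coordinates of `z` in the eigenbasis vanish off the kernel
  set c : n → ℂ := star U *ᵥ z with hc
  have hc0 : ∀ i, hA.eigenvalues i ≠ 0 → c i = 0 := by
    intro i hi
    rw [hc, hU, star_unitary_mulVec_apply]
    -- `λ_i ⟨e_i, z⟩ = ⟨A e_i, z⟩ = ⟨e_i, A z⟩ = 0`
    have h1 : star (A *ᵥ ⇑(hA.eigenvectorBasis i)) ⬝ᵥ z = star (⇑(hA.eigenvectorBasis i)) ⬝ᵥ (A *ᵥ z) := by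
      rw [conj_pairing, hA.eq]
    rw [hz, dotProduct_zero, hA.mulVec_eigenvectorBasis i, star_smul, smul_dotProduct] at h1
    have hne : star (hA.eigenvalues i) ≠ 0 := by rwa [star_trivial]
    exact (smul_eq_zero.mp h1).resolve_left hne
  have hDc : Dp *ᵥ c = 0 := by
    funext i
    rw [hDp, mulVec_diagonal, Pi.zero_apply]
    by_cases hi : hA.eigenvalues i = 0
    · rw [hi]; simp
    · rw [hc0 i hi, mul_zero]
  show (U * Dp * star U) *ᵥ z = 0
  rw [← mulVec_mulVec, ← mulVec_mulVec, ← hc, hDc, mulVec_zero]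

/-- **THE COLUMNS OF `critCov H Q` ARE ORTHOGONAL TO THE CONSTRAINED ZERO MODES**: `Q z = 0 ∧ H z = 0 ⟹ ⟨z, critCov H Q r⟩ = 0` for every `r`. [folklore] -/
theorem critCov_orth_zeroModes {H : Matrix n n ℂ} (hH : H.IsHermitian) (Q : Matrix m n ℂ) {z : n → ℂ} (hzQ : Q *ᵥ z = 0) (hzH : H *ᵥ z = 0)
    (r : n → ℂ) : star z ⬝ᵥ (critCov hH Q *ᵥ r) = 0 := by
  have hB := isHermitian_compress Q hH
  have hBz : (kerProj Q * H * kerProj Q) *ᵥ z = 0 := by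
    rw [← mulVec_mulVec, ← mulVec_mulVec, kerProj_mulVec_of_mem_ker Q hzQ, hzH, mulVec_zero]
  have h1 : hpinv hB *ᵥ z = 0 := hpinv_mulVec_of_ker hB hBz
  unfold critCov
  rw [← mulVec_mulVec, ← mulVec_mulVec, ← kerProj_pairing, kerProj_mulVec_of_mem_ker Q hzQ, ← (hpinv_isHermitian hB).eq, ← conj_pairing,
    h1, star_zero, zero_dotProduct]

end Orth

/-! ## §2 Coercivity of a PSD form on a subspace without null vectors -/

section Coercive

omit [DecidableEq n] in
/-- Scaling a quadratic form: `⟨a•v, H (a•v)⟩ = (star a * a) ⟨v, H v⟩`. [folklore] -/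
theorem quad_smul (H : Matrix n n ℂ) (a : ℂ) (v : n → ℂ) :
    star (a • v) ⬝ᵥ (H *ᵥ (a • v)) = (star a * a) * (star v ⬝ᵥ (H *ᵥ v)) := by
  rw [mulVec_smul, star_smul, smul_dotProduct, dotProduct_smul, smul_eq_mul, smul_eq_mul, mul_assoc]

omit [DecidableEq n] in
/-- The quadratic form `v ↦ re ⟨v, H v⟩` is continuous. [folklore] -/
theorem continuous_quad_re (H : Matrix n n ℂ) : Continuous fun v : n → ℂ => (star v ⬝ᵥ (H *ᵥ v)).re :=
  Complex.continuous_re.comp ((continuous_id.star).dotProduct (continuous_const.matrix_mulVec continuous_id))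

omit [DecidableEq n] in
/-- **COERCIVITY**: a PSD `H₀` with no null vector in the subspace `V` is coercive on `V`: `∃ c > 0, ∀ v ∈ V, c‖v‖² ≤ re⟨v, H₀v⟩` (the unit sphere of
`V` is compact). [folklore] -/
theorem exists_coercive {H₀ : Matrix n n ℂ} (hH₀ : H₀.PosSemidef) (V : Submodule ℂ (n → ℂ)) (hV : ∀ v ∈ V, H₀ *ᵥ v = 0 → v = 0) :
    ∃ c : ℝ, 0 < c ∧ ∀ v ∈ V, c * ‖v‖ ^ 2 ≤ (star v ⬝ᵥ (H₀ *ᵥ v)).re := by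
  classical
  set S : Set (n → ℂ) := {v | v ∈ V ∧ ‖v‖ = 1} with hS
  have hSc : IsCompact S := by
    refine Metric.isCompact_of_isClosed_isBounded (V.closed_of_finiteDimensional.inter (isClosed_eq continuous_norm continuous_const)) ?_
    refine (Metric.isBounded_iff_subset_closedBall (0 : n → ℂ)).mpr ⟨1, fun v hv => ?_⟩
    rw [Metric.mem_closedBall, dist_zero_right]; exact hv.2.le
  by_cases hne : S.Nonempty
  · obtain ⟨v₀, hv₀S, hmin⟩ := hSc.exists_isMinOn hne (continuous_quad_re H₀).continuousOn
    set c := (star v₀ ⬝ᵥ (H₀ *ᵥ v₀)).re with hc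
    have hc0 : 0 ≤ c := by rw [hc]; exact (Complex.nonneg_iff.mp (hH₀.dotProduct_mulVec_nonneg v₀)).1
    have hcpos : 0 < c := by
      refine hc0.lt_or_eq.resolve_right fun h => ?_
      have hre : (star v₀ ⬝ᵥ (H₀ *ᵥ v₀)).re = 0 := by rw [← hc]; exact h.symm
      have hz : star v₀ ⬝ᵥ (H₀ *ᵥ v₀) = 0 :=
        Complex.ext (by rw [hre, Complex.zero_re]) (by simpa using hH₀.isHermitian.im_star_dotProduct_mulVec_self v₀)
      have : ‖v₀‖ = 1 := hv₀S.2
      rw [hV v₀ hv₀S.1 ((hH₀.dotProduct_mulVec_zero_iff v₀).mp hz), norm_zero] at this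
      exact zero_ne_one this
    refine ⟨c, hcpos, fun v hv => ?_⟩
    by_cases hv0 : v = 0
    · rw [hv0, norm_zero]; simp
    · have hnv : ‖v‖ ≠ 0 := norm_ne_zero_iff.mpr hv0
      set w : n → ℂ := ((‖v‖⁻¹ : ℝ) : ℂ) • v with hw
      have hwS : w ∈ S := by
        refine ⟨V.smul_mem _ hv, ?_⟩
        rw [hw, norm_smul, Complex.norm_real, Real.norm_eq_abs, abs_inv, abs_norm, inv_mul_cancel₀ hnv]
      have hle : c ≤ (star w ⬝ᵥ (H₀ *ᵥ w)).re := hmin hwS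
      have e : (star w ⬝ᵥ (H₀ *ᵥ w)).re = ‖v‖⁻¹ ^ 2 * (star v ⬝ᵥ (H₀ *ᵥ v)).re := by
        rw [hw, quad_smul, Complex.star_def, Complex.conj_ofReal, ← Complex.ofReal_mul, Complex.re_ofReal_mul, sq]
      rw [e] at hle
      calc c * ‖v‖ ^ 2 ≤ ‖v‖⁻¹ ^ 2 * (star v ⬝ᵥ (H₀ *ᵥ v)).re * ‖v‖ ^ 2 := mul_le_mul_of_nonneg_right hle (sq_nonneg _)
        _ = (star v ⬝ᵥ (H₀ *ᵥ v)).re := by field_simp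
  · -- `S = ∅`: then `V = 0`
    refine ⟨1, one_pos, fun v hv => ?_⟩
    by_cases hv0 : v = 0
    · rw [hv0, norm_zero]; simp
    · refine absurd ⟨((‖v‖⁻¹ : ℝ) : ℂ) • v, V.smul_mem _ hv, ?_⟩ hne
      rw [norm_smul, Complex.norm_real, Real.norm_eq_abs, abs_inv, abs_norm, inv_mul_cancel₀ (norm_ne_zero_iff.mpr hv0)]

end Coercive

/-! ## §3 Entrywise limits of monotone chains of forms -/

section Limits

variable {H : ℕ → Matrix n n ℂ}

omit [Fintype n] [DecidableEq n] in
/-- Along an increasing chain, `H k ≤ H k'` for `k ≤ k'`. [folklore] -/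
theorem posSemidef_sub_of_mono (hmono : ∀ k, (H (k + 1) - H k).PosSemidef) {k k' : ℕ} (hk : k ≤ k') : (H k' - H k).PosSemidef := by
  induction hk with
  | refl => rw [sub_self]; exact PosSemidef.zero
  | @step j _ ih => rw [← sub_add_sub_cancel (H (j + 1)) (H j) (H k)]; exact (hmono j).add ih

omit [DecidableEq n] in
/-- Entrywise convergence ⟹ convergence of `A v` coordinatewise. [folklore] -/
theorem tendsto_mulVec_apply {Hinf : Matrix n n ℂ} (hlim : ∀ a b, Tendsto (fun k => H k a b) atTop (𝓝 (Hinf a b))) (v : n → ℂ) (a : n) :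
    Tendsto (fun k => (H k *ᵥ v) a) atTop (𝓝 ((Hinf *ᵥ v) a)) := by
  simp only [mulVec, dotProduct]
  exact tendsto_finsetSum _ fun b _ => (hlim a b).mul tendsto_const_nhds

omit [DecidableEq n] in
/-- Entrywise convergence ⟹ convergence of every sesquilinear pairing `⟨w, H k v⟩`. [folklore] -/
theorem tendsto_pairing {Hinf : Matrix n n ℂ} (hlim : ∀ a b, Tendsto (fun k => H k a b) atTop (𝓝 (Hinf a b))) (w v : n → ℂ) :
    Tendsto (fun k => star w ⬝ᵥ (H k *ᵥ v)) atTop (𝓝 (star w ⬝ᵥ (Hinf *ᵥ v))) := by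
  simp only [dotProduct]
  exact tendsto_finsetSum _ fun a _ => tendsto_const_nhds.mul (tendsto_mulVec_apply hlim v a)

omit [Fintype n] [DecidableEq n] in
/-- The entrywise limit of Hermitian matrices is Hermitian. [folklore] -/
theorem isHermitian_of_tendsto (hH : ∀ k, (H k).IsHermitian) {Hinf : Matrix n n ℂ}
    (hlim : ∀ a b, Tendsto (fun k => H k a b) atTop (𝓝 (Hinf a b))) : Hinf.IsHermitian := by
  ext a b
  rw [conjTranspose_apply]
  have h1 : Tendsto (fun k => star (H k b a)) atTop (𝓝 (star (Hinf b a))) := (continuous_star.tendsto _).comp (hlim b a)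
  rw [show (fun k => star (H k b a)) = fun k => H k a b from funext fun k => by rw [← conjTranspose_apply, (hH k).eq]] at h1
  exact tendsto_nhds_unique h1 (hlim a b)

omit [DecidableEq n] in
/-- The entrywise limit of PSD matrices is PSD. [folklore] -/
theorem posSemidef_of_tendsto {G : ℕ → Matrix n n ℂ} (hG : ∀ k, (G k).PosSemidef) {Ginf : Matrix n n ℂ}
    (hlim : ∀ a b, Tendsto (fun k => G k a b) atTop (𝓝 (Ginf a b))) : Ginf.PosSemidef := by
  refine posSemidef_of_isHermitian_re_nonneg (isHermitian_of_tendsto (fun k => (hG k).isHermitian) hlim) fun x => ?_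
  have ht := (Complex.continuous_re.tendsto _).comp (tendsto_pairing hlim x x)
  exact ge_of_tendsto ht (Filter.Eventually.of_forall fun k => (Complex.nonneg_iff.mp ((hG k).dotProduct_mulVec_nonneg x)).1)

omit [DecidableEq n] in
/-- **THE LIMIT DOMINATES THE CHAIN**: `H k ≤ Hinf` for every `k`. [folklore] -/
theorem posSemidef_limit_sub (hmono : ∀ k, (H (k + 1) - H k).PosSemidef) {Hinf : Matrix n n ℂ}
    (hlim : ∀ a b, Tendsto (fun k => H k a b) atTop (𝓝 (Hinf a b))) (k : ℕ) : (Hinf - H k).PosSemidef := by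
  -- `Hinf − H k` is the entrywise limit of the PSD matrices `H (k + j) − H k`
  refine posSemidef_of_tendsto (fun j => posSemidef_sub_of_mono hmono (Nat.le_add_right k j)) fun a b => ?_
  simp only [Matrix.sub_apply]
  have h1 : Tendsto (fun j => H (k + j) a b) atTop (𝓝 (Hinf a b)) := by
    rw [show (fun j => H (k + j) a b) = (fun k' => H k' a b) ∘ (fun j => j + k) from funext fun j => by simp [Nat.add_comm]]
    exact (hlim a b).comp (tendsto_add_atTop_nat k)
  exact h1.sub tendsto_const_nhds

omit [Fintype n] [DecidableEq n] in
/-- **AN INCREASING CHAIN BOUNDED ABOVE CONVERGES ENTRYWISE** (gen 1's `MonotoneLimit.exists_tendsto_apply_of_steps` applied to the decreasing PSD chain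
`U − H k`). [folklore] -/
theorem exists_tendsto_of_mono_bounded (hmono : ∀ k, (H (k + 1) - H k).PosSemidef) {U : Matrix n n ℂ} (hU : ∀ k, (U - H k).PosSemidef) :
    ∃ Hinf : Matrix n n ℂ, ∀ a b, Tendsto (fun k => H k a b) atTop (𝓝 (Hinf a b)) := by
  have hstep : ∀ j, 0 ≤ j → ((U - H j) - (U - H (j + 1))).PosSemidef := fun j _ => by rw [sub_sub_sub_cancel_left]; exact hmono j
  obtain ⟨Pinf, hP⟩ := exists_tendsto_apply_of_steps (P := fun j => U - H j) (k₀ := 0) hstep (fun j _ => hU j)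
  refine ⟨U - Pinf, fun a b => ?_⟩
  have h := (tendsto_const_nhds (x := U a b)).sub (hP a b)
  simp only [Matrix.sub_apply, sub_sub_cancel] at h
  simpa only [Matrix.sub_apply] using h

end Limits

/-! ## §4 The pairings of the constrained covariances converge to the pairing of the limit form -/

section Main

variable {H : ℕ → Matrix n n ℂ} {Hinf : Matrix n n ℂ} {Q : Matrix m n ℂ}

omit [DecidableEq n] [Fintype m] [DecidableEq m] in
/-- `|⟨v, A v⟩| ≤ (Σ_{ij} ‖A i j‖)·‖v‖²` (sup norm). [folklore] -/
theorem norm_quad_le (A : Matrix n n ℂ) (v : n → ℂ) : ‖star v ⬝ᵥ (A *ᵥ v)‖ ≤ (∑ i, ∑ j, ‖A i j‖) * ‖v‖ ^ 2 := by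
  simp only [dotProduct, mulVec, Pi.star_apply]
  calc ‖∑ i, star (v i) * ∑ j, A i j * v j‖
      ≤ ∑ i, ‖star (v i) * ∑ j, A i j * v j‖ := norm_sum_le _ _
    _ ≤ ∑ i, ∑ j, ‖A i j‖ * ‖v‖ ^ 2 := by
        refine Finset.sum_le_sum fun i _ => ?_
        rw [norm_mul, norm_star]
        calc ‖v i‖ * ‖∑ j, A i j * v j‖ ≤ ‖v‖ * ∑ j, ‖A i j‖ * ‖v‖ := by
              refine mul_le_mul (norm_le_pi_norm v i) ((norm_sum_le _ _).trans (Finset.sum_le_sum fun j _ => ?_)) (norm_nonneg _)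
                (norm_nonneg _)
              rw [norm_mul]; exact mul_le_mul_of_nonneg_left (norm_le_pi_norm v j) (norm_nonneg _)
          _ = ∑ j, ‖A i j‖ * ‖v‖ ^ 2 := by rw [Finset.mul_sum]; refine Finset.sum_congr rfl fun j _ => ?_; ring
    _ = (∑ i, ∑ j, ‖A i j‖) * ‖v‖ ^ 2 := by rw [Finset.sum_mul]; refine Finset.sum_congr rfl fun i _ => ?_; rw [Finset.sum_mul]

omit [DecidableEq n] [Fintype m] [DecidableEq m] in
/-- `|⟨v, r⟩| ≤ (Σ_i ‖r i‖)·‖v‖`. [folklore] -/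
theorem norm_pairing_le (v r : n → ℂ) : ‖star v ⬝ᵥ r‖ ≤ (∑ i, ‖r i‖) * ‖v‖ := by
  simp only [dotProduct, Pi.star_apply]
  calc ‖∑ i, star (v i) * r i‖ ≤ ∑ i, ‖star (v i) * r i‖ := norm_sum_le _ _
    _ ≤ ∑ i, ‖r i‖ * ‖v‖ := Finset.sum_le_sum fun i _ => by
        rw [norm_mul, norm_star, mul_comm]; exact mul_le_mul_of_nonneg_left (norm_le_pi_norm v i) (norm_nonneg _)
    _ = (∑ i, ‖r i‖) * ‖v‖ := by rw [Finset.sum_mul]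

/-- The subspace `ker Q ∩ (ker Q ∩ ker H₀)^⊥` on which the covariance columns live. [folklore] -/
def colSpace (Q : Matrix m n ℂ) (H₀ : Matrix n n ℂ) : Submodule ℂ (n → ℂ) where
  carrier := {v | Q *ᵥ v = 0 ∧ ∀ z, Q *ᵥ z = 0 → H₀ *ᵥ z = 0 → star z ⬝ᵥ v = 0}
  add_mem' := by
    rintro v w ⟨hv1, hv2⟩ ⟨hw1, hw2⟩
    exact ⟨by rw [mulVec_add, hv1, hw1, add_zero], fun z hzQ hzH => by rw [dotProduct_add, hv2 z hzQ hzH, hw2 z hzQ hzH, add_zero]⟩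
  zero_mem' := ⟨mulVec_zero _, fun z _ _ => dotProduct_zero _⟩
  smul_mem' := by
    rintro c v ⟨hv1, hv2⟩
    exact ⟨by rw [mulVec_smul, hv1, smul_zero], fun z hzQ hzH => by rw [dotProduct_smul, hv2 z hzQ hzH, smul_zero]⟩

omit [DecidableEq n] [Fintype m] [DecidableEq m] in
/-- `H₀` has no null vector in `colSpace Q H₀` except `0`. [folklore] -/
theorem colSpace_noKer {H₀ : Matrix n n ℂ} {v : n → ℂ} (hv : v ∈ colSpace Q H₀) (h0 : H₀ *ᵥ v = 0) : v = 0 :=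
  dotProduct_star_self_eq_zero.mp (hv.2 v hv.1 h0)

/-- **THE PAIRINGS CONVERGE.**  An increasing chain of PSD forms `H k` with entrywise limit `Hinf`, hard rows `Q`, KERNEL STABILITY (`ker Q ∩ ker H₀ ⊆ ker H_k`
for all `k`) and a source `r` invisible to `ker Q ∩ ker H₀`: then `⟨r, critCov (H k) Q r⟩ → ⟨r, critCov Hinf Q r⟩`. [folklore] -/
theorem pairing_critCov_tendsto (hH : ∀ k, (H k).PosSemidef) (hmono : ∀ k, (H (k + 1) - H k).PosSemidef)
    (hlim : ∀ a b, Tendsto (fun k => H k a b) atTop (𝓝 (Hinf a b))) (hker : ∀ k z, Q *ᵥ z = 0 → H 0 *ᵥ z = 0 → H k *ᵥ z = 0)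
    {r : n → ℂ} (hr : ∀ z, Q *ᵥ z = 0 → H 0 *ᵥ z = 0 → star z ⬝ᵥ r = 0) :
    Tendsto (fun k => star r ⬝ᵥ (critCov (hH k).isHermitian Q *ᵥ r)) atTop
      (𝓝 (star r ⬝ᵥ (critCov (posSemidef_of_tendsto hH hlim).isHermitian Q *ᵥ r))) := by
  have hinf : Hinf.PosSemidef := posSemidef_of_tendsto hH hlim
  have hle : ∀ k, (Hinf - H k).PosSemidef := posSemidef_limit_sub hmono hlim
  have hle0 : ∀ k, (H k - H 0).PosSemidef := fun k => posSemidef_sub_of_mono hmono (Nat.zero_le k)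
  -- legitimacy of `r` at every level and at the limit
  have hrk : ∀ k, ∀ z, Q *ᵥ z = 0 → H k *ᵥ z = 0 → star z ⬝ᵥ r = 0 := fun k z hzQ hzH => hr z hzQ (ker_of_ker_larger (hH 0) (hle0 k) hzH)
  have hrinf : ∀ z, Q *ᵥ z = 0 → Hinf *ᵥ z = 0 → star z ⬝ᵥ r = 0 := fun z hzQ hzH => hr z hzQ (ker_of_ker_larger (hH 0) (hle 0) hzH)
  -- the critical points
  set v : ℕ → (n → ℂ) := fun k => critCov (hH k).isHermitian Q *ᵥ r with hv
  set vinf := critCov hinf.isHermitian Q *ᵥ r with hvinf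
  have hcrit : ∀ k, IsCrit (H k) r (LinearMap.ker Q.mulVecLin) (v k) := fun k => isCrit_critCov (hH k) Q (hrk k)
  have hcritinf : IsCrit Hinf r (LinearMap.ker Q.mulVecLin) vinf := isCrit_critCov hinf Q hrinf
  set p : ℕ → ℂ := fun k => star r ⬝ᵥ v k with hp
  set pinf : ℂ := star r ⬝ᵥ vinf with hpinf
  -- (1) `0 ≤ p k − pinf ≤ ⟨v k, (Hinf − H k) v k⟩`
  have hlow : ∀ k, pinf ≤ p k := by
    intro k
    calc pinf = qfun Hinf r vinf := (qfun_crit_eq_pairing hcritinf).symm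
      _ ≤ qfun (H k) r vinf := qfun_mono_form (hle k) r vinf
      _ ≤ qfun (H k) r (v k) := qfun_le_of_isCrit (hH k) (hcrit k) (critCov_mem_ker hinf.isHermitian Q r)
      _ = p k := qfun_crit_eq_pairing (hcrit k)
  have hup : ∀ k, p k - pinf ≤ star (v k) ⬝ᵥ ((Hinf - H k) *ᵥ v k) := by
    intro k
    have h1 : qfun Hinf r (v k) ≤ pinf := by
      rw [hpinf, ← qfun_crit_eq_pairing hcritinf]; exact qfun_le_of_isCrit hinf hcritinf (critCov_mem_ker (hH k).isHermitian Q r)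
    have h2 : qfun Hinf r (v k) = p k - star (v k) ⬝ᵥ ((Hinf - H k) *ᵥ v k) := by
      rw [hp]; simp only
      rw [← qfun_crit_eq_pairing (hcrit k)]
      simp only [qfun, sub_mulVec, dotProduct_sub]; ring
    rw [h2] at h1
    exact sub_le_comm.mp h1
  -- (2) the `v k` lie in the fixed subspace `colSpace Q (H 0)` and are uniformly bounded there
  have hvmem : ∀ k, v k ∈ colSpace Q (H 0) := fun k =>
    ⟨mulVec_critCov_mem_ker (hH k).isHermitian Q r, fun z hzQ hzH => critCov_orth_zeroModes (hH k).isHermitian Q hzQ (hker k z hzQ hzH) r⟩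
  obtain ⟨c, hcpos, hcoer⟩ := exists_coercive (hH 0) (colSpace Q (H 0)) fun w hw h0 => colSpace_noKer hw h0
  set R : ℝ := ∑ i, ‖r i‖ with hR
  have hbound : ∀ k, ‖v k‖ ≤ R / c := by
    intro k
    -- `c‖v‖² ≤ re⟨v, H₀ v⟩ ≤ re⟨v, H_k v⟩ = re⟨v, r⟩ ≤ R‖v‖`
    have h1 : c * ‖v k‖ ^ 2 ≤ (star (v k) ⬝ᵥ (H 0 *ᵥ v k)).re := hcoer (v k) (hvmem k)
    have h2 : (star (v k) ⬝ᵥ (H 0 *ᵥ v k)).re ≤ (star (v k) ⬝ᵥ (H k *ᵥ v k)).re := by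
      have h' := (Complex.nonneg_iff.mp ((hle0 k).dotProduct_mulVec_nonneg (v k))).1
      rw [sub_mulVec, dotProduct_sub, Complex.sub_re] at h'
      linarith
    have h3 : star (v k) ⬝ᵥ (H k *ᵥ v k) = star (v k) ⬝ᵥ r := by
      have h := (hcrit k).2 (v k) (hcrit k).1
      rw [dotProduct_sub, sub_eq_zero] at h; exact h.symm
    have h4 : (star (v k) ⬝ᵥ r).re ≤ R * ‖v k‖ := (Complex.re_le_norm _).trans (norm_pairing_le (v k) r)
    have h5 : c * ‖v k‖ ^ 2 ≤ R * ‖v k‖ := by rw [h3] at h2; linarith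
    by_cases hv0 : ‖v k‖ = 0
    · rw [hv0]; exact div_nonneg (Finset.sum_nonneg fun i _ => norm_nonneg _) hcpos.le
    · rw [le_div_iff₀ hcpos]
      have : c * ‖v k‖ * ‖v k‖ ≤ R * ‖v k‖ := by rw [mul_assoc, ← sq]; exact h5
      linarith [le_of_mul_le_mul_right this (lt_of_le_of_ne (norm_nonneg _) (Ne.symm hv0)), mul_comm c ‖v k‖]
  -- (3) the error `⟨v k, (Hinf − H k) v k⟩` tends to zero
  have herr : Tendsto (fun k => (∑ i, ∑ j, ‖(Hinf - H k) i j‖) * (R / c) ^ 2) atTop (𝓝 0) := by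
    have h1 : Tendsto (fun k => ∑ i, ∑ j, ‖(Hinf - H k) i j‖) atTop (𝓝 0) := by
      rw [show (0 : ℝ) = ∑ i : n, ∑ j : n, (0 : ℝ) by simp]
      refine tendsto_finsetSum _ fun i _ => tendsto_finsetSum _ fun j _ => ?_
      have h' := ((tendsto_const_nhds (x := Hinf i j)).sub (hlim i j)).norm
      rw [sub_self, norm_zero] at h'
      simpa only [Matrix.sub_apply] using h'
    simpa using h1.mul_const ((R / c) ^ 2)
  -- (4) squeeze
  rw [Metric.tendsto_atTop]
  intro ε hε
  obtain ⟨N, hN⟩ := (Metric.tendsto_atTop.mp herr) ε hε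
  refine ⟨N, fun k hk => ?_⟩
  have hk' := hN k hk
  rw [Real.dist_eq, sub_zero, abs_of_nonneg (mul_nonneg (Finset.sum_nonneg fun i _ => Finset.sum_nonneg fun j _ => norm_nonneg _)
    (sq_nonneg _))] at hk'
  rw [dist_eq_norm]
  calc ‖p k - pinf‖ ≤ ‖star (v k) ⬝ᵥ ((Hinf - H k) *ᵥ v k)‖ := CStarAlgebra.norm_le_norm_of_nonneg_of_le (sub_nonneg.mpr (hlow k)) (hup k)
    _ ≤ (∑ i, ∑ j, ‖(Hinf - H k) i j‖) * ‖v k‖ ^ 2 := norm_quad_le _ _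
    _ ≤ (∑ i, ∑ j, ‖(Hinf - H k) i j‖) * (R / c) ^ 2 := by
        refine mul_le_mul_of_nonneg_left ?_ (Finset.sum_nonneg fun i _ => Finset.sum_nonneg fun j _ => norm_nonneg _)
        exact pow_le_pow_left₀ (norm_nonneg _) (hbound k) 2
    _ < ε := hk'

/-! ## §5 Entrywise convergence of the read-out matrices (polarisation) -/

omit [DecidableEq n] [Fintype m] [DecidableEq m] in
/-- Polarisation: an entry of `X Γ Xᴴ` from four quadratic forms. [folklore] -/
theorem readOut_apply_polar (X : Matrix τ n ℂ) (Γ : Matrix n n ℂ) (a b : τ) :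
    (X * Γ * Xᴴ) a b
      = ((star (Pi.single a 1 + Pi.single b 1) ⬝ᵥ ((X * Γ * Xᴴ) *ᵥ (Pi.single a 1 + Pi.single b 1))
          - star (Pi.single a (1 : ℂ)) ⬝ᵥ ((X * Γ * Xᴴ) *ᵥ Pi.single a 1) - star (Pi.single b (1 : ℂ)) ⬝ᵥ ((X * Γ * Xᴴ) *ᵥ Pi.single b 1))
        - Complex.I * (star (Pi.single a 1 + Complex.I • Pi.single b 1) ⬝ᵥ ((X * Γ * Xᴴ) *ᵥ (Pi.single a 1 + Complex.I • Pi.single b 1))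
          - star (Pi.single a (1 : ℂ)) ⬝ᵥ ((X * Γ * Xᴴ) *ᵥ Pi.single a 1) - star (Pi.single b (1 : ℂ)) ⬝ᵥ ((X * Γ * Xᴴ) *ᵥ Pi.single b 1))) / 2 := by
  set M := X * Γ * Xᴴ with hM
  have key : ∀ x y : τ → ℂ, star x ⬝ᵥ (M *ᵥ y)
      = ((star (x + y) ⬝ᵥ (M *ᵥ (x + y)) - star x ⬝ᵥ (M *ᵥ x) - star y ⬝ᵥ (M *ᵥ y))
        - Complex.I * (star (x + Complex.I • y) ⬝ᵥ (M *ᵥ (x + Complex.I • y)) - star x ⬝ᵥ (M *ᵥ x) - star y ⬝ᵥ (M *ᵥ y))) / 2 := by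
    intro x y
    simp only [mulVec_add, mulVec_smul, star_add, star_smul, add_dotProduct, dotProduct_add, smul_dotProduct, dotProduct_smul, smul_eq_mul,
      Complex.star_def, Complex.conj_I]
    have hI : Complex.I * Complex.I = -1 := Complex.I_mul_I
    linear_combination ((star x ⬝ᵥ M *ᵥ y - star y ⬝ᵥ M *ᵥ x - Complex.I * (star y ⬝ᵥ M *ᵥ y)) / 2) * hI
  have e : M a b = star (Pi.single a (1 : ℂ)) ⬝ᵥ (M *ᵥ Pi.single b 1) := by
    have hs : star (Pi.single a (1 : ℂ) : τ → ℂ) = Pi.single a 1 := by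
      ext i; by_cases hi : i = a
      · subst hi; simp
      · simp [Pi.single_eq_of_ne hi]
    rw [hs, single_dotProduct, one_mul]
    simp [mulVec, dotProduct, Pi.single_apply]
  rw [e, key]

/-- **ENTRYWISE CONVERGENCE OF THE READ-OUT MATRICES**: under the hypotheses of `pairing_critCov_tendsto`, for every test matrix `T` killing
`ker Q ∩ ker H₀`: `T·critCov (H k) Q·Tᴴ → T·critCov Hinf Q·Tᴴ` entry by entry. [folklore] -/
theorem readOut_critCov_tendsto (hH : ∀ k, (H k).PosSemidef) (hmono : ∀ k, (H (k + 1) - H k).PosSemidef)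
    (hlim : ∀ a b, Tendsto (fun k => H k a b) atTop (𝓝 (Hinf a b))) (hker : ∀ k z, Q *ᵥ z = 0 → H 0 *ᵥ z = 0 → H k *ᵥ z = 0)
    (T : Matrix τ n ℂ) (hT : ∀ z, Q *ᵥ z = 0 → H 0 *ᵥ z = 0 → T *ᵥ z = 0) (a b : τ) :
    Tendsto (fun k => (T * critCov (hH k).isHermitian Q * Tᴴ) a b) atTop
      (𝓝 ((T * critCov (posSemidef_of_tendsto hH hlim).isHermitian Q * Tᴴ) a b)) := by
  have hleg : ∀ u : τ → ℂ, ∀ z, Q *ᵥ z = 0 → H 0 *ᵥ z = 0 → star z ⬝ᵥ (Tᴴ *ᵥ u) = 0 := by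
    intro u z hzQ hzH; rw [← conj_pairing, hT z hzQ hzH, star_zero, zero_dotProduct]
  have hq : ∀ u : τ → ℂ, Tendsto (fun k => star u ⬝ᵥ ((T * critCov (hH k).isHermitian Q * Tᴴ) *ᵥ u)) atTop
      (𝓝 (star u ⬝ᵥ ((T * critCov (posSemidef_of_tendsto hH hlim).isHermitian Q * Tᴴ) *ᵥ u))) := by
    intro u
    simp only [readOut_quad]
    exact pairing_critCov_tendsto hH hmono hlim hker (hleg u)
  simp only [readOut_apply_polar T]
  refine Tendsto.div_const (Tendsto.sub ?_ (Tendsto.const_mul _ ?_)) 2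
  · exact ((hq _).sub (hq _)).sub (hq _)
  · exact ((hq _).sub (hq _)).sub (hq _)

end Main

end Summit.QuantumFields.BalabanUV.Beta.GAN24.MonotoneCovLimit
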